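import Summits.BirchSwinnertonDyer.BirchSwinnertonDyer.Theorems.KimAtThreeSemiLocalTraceDualTwistEuler
import Summits.BirchSwinnertonDyer.BirchSwinnertonDyer.Theorems.KimAtThreeDeepUpperRiderOfCompat
import HarnessLib

/-!
# Route `KimAtThreeKolyvagin` (W2): SCALAR EXTRACTION on the Euler-factor lattice —
# `P_w·L_int ∩ (ℚ_p ⊗ 1) = (p + 1 − a)·ℤ_p ⊗ 1` — and the TWISTED rider (ii_τ) DERIVED from a twisted
# compatibility clause

Cell `bsd-addord`, seat `bsd-addord-w2-acc3` (PROGRAMME PART 1b row (3), gen 6); seventh file of the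
trace-duality set (after `KimAtThreeSemiLocalTraceDualTwist{,Euler}`); `--supports stmt-BirchSwinnertonDyer-19679`
(helper).  TOOL theorems only (no definition, no named fact, no instance, no `sorry`); Kato's value datum `Λ`,
the scalar dual exponential `φ` at `ℚ₃` and the finite-level functional `Λfin` are ABSTRACT binders; nothing is
asserted about any curve; closes nothing; nothing booked; BSD is not proved by any of this.

WHY.  Seat w2-c4 gen 9's fine package (C1_τ) on the good ANOMALOUS rows (`KimAtThreeShallowEqDeepAnomalousFineKato`)
displays the TWISTED rider clause (ii_τ): «`3•Λ_{0,r}(y) − (s·(3 − a₃ + 1)) ⊗ 1 ∈ 3^{j+1}•P_w·L_int ⟹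
Λfin_j(loc κ₀) = s̄`», `P_w = 3 − a₃δ_w + δ_{w²}`, `w·[3] = 1`; its memo (W2C4-ANOMALOUS-PORT-g9 §2) explains why
it is TRUE for Kato's `exp*`: "since `(p^{k+1}E_p(σ_p⁻¹)L_int) ∩ ℚ_p = p^{k+1}E_p(1)ℤ_p`, the singular coordinate
is recovered EXACTLY".  That intersection statement is pure algebra once the Euler twist is INJECTIVE
(`KimAtThreeSemiLocalTraceDualTwistEuler.eulerTwist_bijective`, `a ≠ ±(p+1)`) and a coordinate functional
`τ` with `τ(1 ⊗ 1) = 1`, `τ(L_int) ⊆ ℤ_p` is available (seat w2-c3 gen 7's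
`KimAtThreeDeepUpperRiderOfCompat.exists_coordFunctional`): `P_w·(c ⊗ 1) = ((p + 1 − a)c) ⊗ 1`, so
`c ⊗ 1 = P_w·l` forces `l = (c/(p+1−a)) ⊗ 1` and `τ` reads off `c/(p+1−a) ∈ ℤ_p`.  This file proves it and
then DERIVES (ii_τ) — exactly as w2-c3 gen 7 derived the untwisted two-exponent rider (`rider₂_of_compat`) —
from the interface of a normalised functional and ONE twisted compatibility clause (X1-int_τ):
«`∃ l ∈ L_int, 3•(φ(h) ⊗ 1 − Λ_{0,r}(y)) = 3^{j+1}•P_w·l`» (for Kato's witnesses: `exp*` commutes with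
restriction and the EXACT lattice lemma `exp*_ω(H¹(L_w,T)) = 3⁻¹P_w·𝒪_w` on anomalous rows — NOT proved here).

* §1 `tensorSigma_tmul_one`, `eulerTwist_tmul_one` (`P_w·(c ⊗ 1) = ((p − a + 1)c) ⊗ 1`), `sum_smul_tensorSigma_add`
  (the twist is additive; `ℤ_p`-homogeneity is w2-c4's `smul_sum_coeff_smul_tensorSigma`).
* §2 ★ `norm_le_one_of_tmul_one_eq_eulerTwist` — **`c ⊗ 1 ∈ P_w·L_int ⟹ ‖c/(p − a + 1)‖ ≤ 1`** (any `m`;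
  `a ≠ ±(p+1)`), with converse `eulerTwist_tmul_one_mem`; ★★ `toZModPow_eq_of_sub_eq_smul_eulerTwist` — the
  mod-`p^{k+1}` form: `(e(p−a+1)) ⊗ 1 − v ∈ p^{k+1}P_w·L ∧ v − (s(p−a+1)) ⊗ 1 ∈ p^{k+1}P_w·L ⟹ e ≡ s (mod p^{k+1})`.
* §3 ★★★ `riderτ_of_compatτ` (`p = 3`) — the (ii_τ) clause of (C1_τ) VERBATIM (any `j`, the place `v₃`, every
  `w` with `w·[3] = 1`) from: the interface `φ′(y) = s ⇒ Λfin_j(π_{j+1,*}y) = s̄` (seat w2-c3's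
  `KimAtThreeDeepUpperLocalLatticeUniform` supplies such `Λfin_j` for a normalised `φ′`), the anomalous
  normalisation `(3 − a + 1)·φ′ = 3·φ` (`Λfin := exp*_ω/E₃(1)`), and (X1-int_τ).

HONEST LIMITS: pure algebra + bookkeeping; (X1-int_τ) for Kato's witnesses is the EXACT lattice lemma + base
change of `exp*` — displayed, not proved; `a ≠ ±(p+1)` (every `a_p` in the Hasse range; at `p = 3`: `|a₃| ≤ 3`).

References: [Kim2022StructureSelmer] §3.3–§3.4.1, Lemma 3.4, Cor. 3.5 and the proof of Thm. 3.13;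
[KimNakamura2020] Thm. 2.1 / Cor. 2.4; [BlochKato1990] §3 (Prop. 3.8); [Kato2004Asterisque] §9.4, Thm. 9.7;
[MazurRubin2004] Thm. 5.2.12; bookkeeping [folklore].
-/

set_option autoImplicit false
-- the Theorems namespace of a single-conjunct summit repeats the summit name by design (D-0017)
set_option linter.dupNamespace false
-- `CyclotomicField m ℚ`'s two `ℚ`-algebra structures agree only up to unfolding (as in the sibling files)
set_option backward.isDefEq.respectTransparency false

noncomputable section

open scoped TensorProduct NumberField BigOperators ContRepresentation
open NumberField IsDedekindDomain WeierstrassCurve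
open Literature.NumberTheory.GaloisRepresentations Literature.NumberTheory.GaloisCohomology
open Literature.NumberTheory.GaloisRepresentations.DiscreteGaloisModule
open Literature.NumberTheory.EllipticCurves
open Literature.NumberTheory.EllipticCurves.Kato2004 Literature.NumberTheory.EllipticCurves.Kato2004.EulerSystemValues
open Summit.BirchSwinnertonDyer.Rank1Residual.GaloisImage
open Summit.BirchSwinnertonDyer.Rank1Residual.GaloisImage.GroupRingEval
open Summit.BirchSwinnertonDyer.BirchSwinnertonDyer.Theorems.KimAtThreePortSharedSATCore
open Summit.BirchSwinnertonDyer.BirchSwinnertonDyer.Theorems.KimAtThreeSemiLocalTraceDualTwist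
open Summit.BirchSwinnertonDyer.BirchSwinnertonDyer.Theorems.KimAtThreeSemiLocalTraceDualTwistEuler

namespace Summit.BirchSwinnertonDyer.BirchSwinnertonDyer.Theorems.KimAtThreeSemiLocalTraceDualTwistScalar

/-! ### §1 The Euler twist on scalars `ℚ_p ⊗ 1` and its additivity -/

section Algebra

variable (m : ℕ) [NeZero m] (p : ℕ) [Fact p.Prime]

/-- `(1 ⊗ σ_g)(c ⊗ 1) = c ⊗ 1`: the Galois action fixes the scalars `ℚ_p ⊗ 1`. [folklore] -/
theorem tensorSigma_tmul_one (g : (ZMod m)ˣ) (c : ℚ_[p]) :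
    Algebra.TensorProduct.map (AlgHom.id ℚ ℚ_[p])
        (sigma m g : CyclotomicField m ℚ →ₐ[ℚ] CyclotomicField m ℚ) (c ⊗ₜ[ℚ] (1 : CyclotomicField m ℚ)) =
      c ⊗ₜ[ℚ] (1 : CyclotomicField m ℚ) := by
  rw [Algebra.TensorProduct.map_tmul, AlgHom.coe_id, id_eq, map_one]

/-- **`P_w·(c ⊗ 1) = ((p − a + 1)·c) ⊗ 1`**: on scalars the Euler twist `p − a·δ_w + δ_{w²}` acts through its
augmentation `p − a + 1 = #Ẽ(𝔽_p)` (when `a = a_p`). [folklore] -/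
theorem eulerTwist_tmul_one (w : (ZMod m)ˣ) (a : ℤ) (c : ℚ_[p]) :
    ∑ g : (ZMod m)ˣ, (((((p : ℕ) : MonoidAlgebra ℤ_[p] (ZMod m)ˣ) -
        MonoidAlgebra.single w (a : ℤ_[p]) + MonoidAlgebra.single (w ^ 2) (1 : ℤ_[p])).coeff g :
          ℤ_[p]) : ℚ_[p]) • Algebra.TensorProduct.map (AlgHom.id ℚ ℚ_[p])
            (sigma m g : CyclotomicField m ℚ →ₐ[ℚ] CyclotomicField m ℚ) (c ⊗ₜ[ℚ] (1 : CyclotomicField m ℚ)) =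
      ((((p : ℤ_[p]) - (a : ℤ_[p]) + 1 : ℤ_[p]) : ℚ_[p]) * c) ⊗ₜ[ℚ] (1 : CyclotomicField m ℚ) := by
  rw [eulerTwist_apply, tensorSigma_tmul_one, tensorSigma_tmul_one, TensorProduct.smul_tmul',
    TensorProduct.smul_tmul', smul_eq_mul, smul_eq_mul, ← TensorProduct.sub_tmul, ← TensorProduct.add_tmul,
    PadicInt.coe_add, PadicInt.coe_sub, PadicInt.coe_natCast, PadicInt.coe_intCast, PadicInt.coe_one]
  congr 1
  ring

/-- The group-ring action `v ↦ Σ_g c_g • (1 ⊗ σ_g) v` is additive. [folklore] -/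
theorem sum_smul_tensorSigma_add (c : (ZMod m)ˣ → ℚ_[p]) (x y : ℚ_[p] ⊗[ℚ] CyclotomicField m ℚ) :
    ∑ g : (ZMod m)ˣ, c g • Algebra.TensorProduct.map (AlgHom.id ℚ ℚ_[p])
        (sigma m g : CyclotomicField m ℚ →ₐ[ℚ] CyclotomicField m ℚ) (x + y) =
      ∑ g : (ZMod m)ˣ, c g • Algebra.TensorProduct.map (AlgHom.id ℚ ℚ_[p])
        (sigma m g : CyclotomicField m ℚ →ₐ[ℚ] CyclotomicField m ℚ) x +
      ∑ g : (ZMod m)ˣ, c g • Algebra.TensorProduct.map (AlgHom.id ℚ ℚ_[p])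
        (sigma m g : CyclotomicField m ℚ →ₐ[ℚ] CyclotomicField m ℚ) y := by
  rw [← Finset.sum_add_distrib]
  refine Finset.sum_congr rfl fun g _ => ?_
  rw [map_add, smul_add]

/-! ### §2 Scalar extraction on the twisted lattice `P_w·L_int` -/

/-- **`((p − a + 1)·t) ⊗ 1 ∈ P_w·L_int` for `t ∈ ℤ_p`** (the easy inclusion: `= P_w·(t ⊗ 1)`). [folklore] -/
theorem eulerTwist_tmul_one_mem (w : (ZMod m)ˣ) (a : ℤ) (t : ℤ_[p]) :
    ∃ l ∈ cycIntLattice p m, ((((p : ℤ_[p]) - (a : ℤ_[p]) + 1 : ℤ_[p]) : ℚ_[p]) * (t : ℚ_[p])) ⊗ₜ[ℚ]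
        (1 : CyclotomicField m ℚ) =
      ∑ g : (ZMod m)ˣ, (((((p : ℕ) : MonoidAlgebra ℤ_[p] (ZMod m)ˣ) -
        MonoidAlgebra.single w (a : ℤ_[p]) + MonoidAlgebra.single (w ^ 2) (1 : ℤ_[p])).coeff g :
          ℤ_[p]) : ℚ_[p]) • Algebra.TensorProduct.map (AlgHom.id ℚ ℚ_[p])
            (sigma m g : CyclotomicField m ℚ →ₐ[ℚ] CyclotomicField m ℚ) l :=
  ⟨(t : ℚ_[p]) ⊗ₜ[ℚ] (1 : CyclotomicField m ℚ), coe_tmul_one_mem_cycIntLattice p m t,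
    (eulerTwist_tmul_one m p w a (t : ℚ_[p])).symm⟩

/-- ★ **`P_w·L_int ∩ (ℚ_p ⊗ 1) ⊆ (p − a + 1)·ℤ_p ⊗ 1`** (`a ≠ ±(p+1)`, any `m`): if `c ⊗ 1 = P_w·l` with
`l ∈ L_int`, then `‖c/(p − a + 1)‖ ≤ 1`.  Injectivity of `P_w` (`eulerTwist_bijective`) pins
`l = (c/(p−a+1)) ⊗ 1`, and seat w2-c3's coordinate functional `τ` (`τ(1 ⊗ 1) = 1`, `τ(L_int) ⊆ ℤ_p`) reads the
scalar off.  (w2-c4 gen 9: "`(p^{k+1}E_p(σ_p⁻¹)L_int) ∩ ℚ_p = p^{k+1}E_p(1)ℤ_p`".)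
[cite: Kim2022StructureSelmer, Lemma 3.4 and the proof of Thm. 3.13 (arXiv v3 pp. 17–18, 26–28)] -/
theorem norm_le_one_of_tmul_one_eq_eulerTwist (w : (ZMod m)ˣ) {a : ℤ} (ha : a ≠ (p : ℤ) + 1)
    (ha' : a ≠ -((p : ℤ) + 1)) {c : ℚ_[p]} {l : ℚ_[p] ⊗[ℚ] CyclotomicField m ℚ}
    (hl : l ∈ cycIntLattice p m)
    (hc : c ⊗ₜ[ℚ] (1 : CyclotomicField m ℚ) =
      ∑ g : (ZMod m)ˣ, (((((p : ℕ) : MonoidAlgebra ℤ_[p] (ZMod m)ˣ) -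
        MonoidAlgebra.single w (a : ℤ_[p]) + MonoidAlgebra.single (w ^ 2) (1 : ℤ_[p])).coeff g :
          ℤ_[p]) : ℚ_[p]) • Algebra.TensorProduct.map (AlgHom.id ℚ ℚ_[p])
            (sigma m g : CyclotomicField m ℚ →ₐ[ℚ] CyclotomicField m ℚ) l) :
    ‖c / ((((p : ℤ_[p]) - (a : ℤ_[p]) + 1 : ℤ_[p]) : ℚ_[p]))‖ ≤ 1 := by
  -- the augmentation `p − a + 1 ≠ 0`
  have haug : ((((p : ℤ_[p]) - (a : ℤ_[p]) + 1 : ℤ_[p]) : ℚ_[p])) ≠ 0 := by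
    rw [PadicInt.coe_add, PadicInt.coe_sub, PadicInt.coe_natCast, PadicInt.coe_intCast, PadicInt.coe_one]
    intro h0
    apply ha
    have h1 : ((a : ℤ) : ℚ_[p]) = ((p : ℤ) + 1 : ℤ) := by push_cast; linear_combination -h0
    exact_mod_cast h1
  -- `P_w·((c/(p−a+1)) ⊗ 1) = c ⊗ 1 = P_w·l`, so `l = (c/(p−a+1)) ⊗ 1`
  have hinj := (eulerTwist_bijective m p w ha ha').1
  have heq : l = (c / ((((p : ℤ_[p]) - (a : ℤ_[p]) + 1 : ℤ_[p]) : ℚ_[p]))) ⊗ₜ[ℚ]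
      (1 : CyclotomicField m ℚ) := by
    apply hinj
    dsimp only
    rw [← hc, eulerTwist_tmul_one, mul_div_cancel₀ _ haug]
  -- read off with `τ`
  obtain ⟨τ, hτ1, hτ⟩ := KimAtThreeDeepUpperRiderOfCompat.exists_coordFunctional p m
  have h := hτ l hl
  have htl : τ l = c / ((((p : ℤ_[p]) - (a : ℤ_[p]) + 1 : ℤ_[p]) : ℚ_[p])) := by
    rw [heq, show (c / ((((p : ℤ_[p]) - (a : ℤ_[p]) + 1 : ℤ_[p]) : ℚ_[p]))) ⊗ₜ[ℚ] (1 : CyclotomicField m ℚ) =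
        (c / ((((p : ℤ_[p]) - (a : ℤ_[p]) + 1 : ℤ_[p]) : ℚ_[p]))) • ((1 : ℚ_[p]) ⊗ₜ[ℚ] (1 : CyclotomicField m ℚ)) by
      rw [TensorProduct.smul_tmul', smul_eq_mul, mul_one], map_smul, hτ1, smul_eq_mul, mul_one]
  rwa [htl] at h

/-- ★★ **Scalar extraction modulo `p^{k+1}` on the twisted lattice** (`a ≠ ±(p+1)`, any `m`, any
`v ∈ ℚ_p ⊗ ℚ(ζ_m)`): `(e·(p − a + 1)) ⊗ 1 − v ∈ p^{k+1}•P_w·L_int` and `v − (s·(p − a + 1)) ⊗ 1 ∈ p^{k+1}•P_w·L_int`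
give `e ≡ s (mod p^{k+1})` — the twisted twin of seat w2-c3's `toZModPow_eq_of_sub_eq_smul_cycIntLattice`
(injectivity of `P_w` moves the question back to `L_int`, where their coordinate functional decides it).
[cite: Kim2022StructureSelmer, §3.4.1 and the proof of Thm. 3.13 (arXiv v3 pp. 26–28)] -/
theorem toZModPow_eq_of_sub_eq_smul_eulerTwist (w : (ZMod m)ˣ) {a : ℤ} (ha : a ≠ (p : ℤ) + 1)
    (ha' : a ≠ -((p : ℤ) + 1)) {e s : ℤ_[p]} {v : ℚ_[p] ⊗[ℚ] CyclotomicField m ℚ} {k : ℕ}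
    (he : ∃ μ ∈ cycIntLattice p m,
      (((e * ((p : ℤ_[p]) - (a : ℤ_[p]) + 1) : ℤ_[p]) : ℚ_[p]) ⊗ₜ[ℚ] (1 : CyclotomicField m ℚ)) - v =
        ((p : ℤ_[p]) ^ (k + 1)) • ∑ g : (ZMod m)ˣ, (((((p : ℕ) : MonoidAlgebra ℤ_[p] (ZMod m)ˣ) -
          MonoidAlgebra.single w (a : ℤ_[p]) + MonoidAlgebra.single (w ^ 2) (1 : ℤ_[p])).coeff g :
            ℤ_[p]) : ℚ_[p]) • Algebra.TensorProduct.map (AlgHom.id ℚ ℚ_[p])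
              (sigma m g : CyclotomicField m ℚ →ₐ[ℚ] CyclotomicField m ℚ) μ)
    (hs : ∃ l ∈ cycIntLattice p m,
      v - (((s * ((p : ℤ_[p]) - (a : ℤ_[p]) + 1) : ℤ_[p]) : ℚ_[p]) ⊗ₜ[ℚ] (1 : CyclotomicField m ℚ)) =
        ((p : ℤ_[p]) ^ (k + 1)) • ∑ g : (ZMod m)ˣ, (((((p : ℕ) : MonoidAlgebra ℤ_[p] (ZMod m)ˣ) -
          MonoidAlgebra.single w (a : ℤ_[p]) + MonoidAlgebra.single (w ^ 2) (1 : ℤ_[p])).coeff g :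
            ℤ_[p]) : ℚ_[p]) • Algebra.TensorProduct.map (AlgHom.id ℚ ℚ_[p])
              (sigma m g : CyclotomicField m ℚ →ₐ[ℚ] CyclotomicField m ℚ) l) :
    PadicInt.toZModPow (k + 1) e = PadicInt.toZModPow (k + 1) s := by
  obtain ⟨μ, hμ, he⟩ := he
  obtain ⟨l, hl, hs⟩ := hs
  -- `((e − s)(p − a + 1)) ⊗ 1 = p^{k+1} • P_w·(μ + l) = P_w·(p^{k+1} • (μ + l))`
  have hsum : ((((e - s) * ((p : ℤ_[p]) - (a : ℤ_[p]) + 1) : ℤ_[p]) : ℚ_[p]) ⊗ₜ[ℚ]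
      (1 : CyclotomicField m ℚ)) =
      ∑ g : (ZMod m)ˣ, (((((p : ℕ) : MonoidAlgebra ℤ_[p] (ZMod m)ˣ) -
        MonoidAlgebra.single w (a : ℤ_[p]) + MonoidAlgebra.single (w ^ 2) (1 : ℤ_[p])).coeff g :
          ℤ_[p]) : ℚ_[p]) • Algebra.TensorProduct.map (AlgHom.id ℚ ℚ_[p])
            (sigma m g : CyclotomicField m ℚ →ₐ[ℚ] CyclotomicField m ℚ)
            (((p : ℤ_[p]) ^ (k + 1)) • (μ + l)) := by
    rw [← KimAtThreeShallowEqDeepAnomalousGlue.smul_sum_coeff_smul_tensorSigma, sum_smul_tensorSigma_add,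
      smul_add, ← he, ← hs, sub_add_sub_cancel, ← TensorProduct.sub_tmul, ← PadicInt.coe_sub, ← sub_mul]
  -- so `(e − s) ⊗ 1 ∈ L_int` up to `p^{k+1}`: injectivity of `P_w`
  have hinj := (eulerTwist_bijective m p w ha ha').1
  have heq : ((p : ℤ_[p]) ^ (k + 1)) • (μ + l) =
      (((e - s : ℤ_[p]) : ℚ_[p]) ⊗ₜ[ℚ] (1 : CyclotomicField m ℚ)) := by
    apply hinj
    dsimp only
    rw [← hsum, eulerTwist_tmul_one, PadicInt.coe_mul, mul_comm]
  -- conclude with w2-c3's scalar extraction on `L_int` (`v := s ⊗ 1`)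
  refine KimAtThreeDeepUpperRiderOfCompat.toZModPow_eq_of_sub_eq_smul_cycIntLattice p m
    (v := ((s : ℚ_[p]) ⊗ₜ[ℚ] (1 : CyclotomicField m ℚ))) ⟨μ + l, add_mem hμ hl, ?_⟩
    ⟨0, zero_mem _, by rw [sub_self, smul_zero]⟩
  rw [heq, PadicInt.coe_sub, TensorProduct.sub_tmul]

end Algebra

/-! ### §3 The twisted rider (ii_τ) DERIVED from the interface and a twisted compatibility clause (`p = 3`) -/

section Rider

open scoped Classical
open Field

/-- Local notation: the TWISTED rider clause (ii_τ) at depth `j`, place `v`, for the pair `(Λ, Λf)` and the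
coefficient `a` (= `a₃`) — seat w2-c4 gen 9's spelling (`KimAtThreeShallowEqDeepAnomalousRider` /
`…AnomalousFineKato`'s (C1_τ), fourth conjunct), copied VERBATIM with `t₃ ↦ a` and `j` fixed. -/
local notation3 (prettyPrint := false) "RIDERτ⟦" W' ", " j ", " v' ", " Λ' ", " Λf ", " a' "⟧" =>
  ∀ (r : Finset (HeightOneSpectrum (𝓞 ℚ))) (w : (ZMod (cycLevel 3 0 r))ˣ),
    (w : ZMod (cycLevel 3 0 r)) * ((3 : ℕ) : ZMod (cycLevel 3 0 r)) = 1 →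
    ∀ (Ψ : H1 (tateRep W' 3) (cycSubgroup 3 0 r) →+
      continuousCohomology 1
        (subgroupRep (WeierstrassCurve.torsionGaloisModule W' (((3 : ℕ) : ℤ) ^ j * ((3 : ℕ) : ℤ))).toTopRep
          (cycSubgroup 3 0 r))),
    (∀ (φ : contOneCocycles (subgroupRep (tateRep W' 3).toTopRep (cycSubgroup 3 0 r)))
        (ψ : contOneCocycles
          (subgroupRep (WeierstrassCurve.torsionGaloisModule W' (((3 : ℕ) : ℤ) ^ j * ((3 : ℕ) : ℤ))).toTopRep
            (cycSubgroup 3 0 r))),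
        (∀ g, ((ψ.1 g : geomTorsion W' (((3 : ℕ) : ℤ) ^ j * ((3 : ℕ) : ℤ))) : geomPoints W') =
          TateModule.proj 3 (j + 1) (φ.1 g)) →
        Ψ (oneCocycleClass _ φ) = oneCocycleClass _ ψ) →
    ∀ (y : H1 (tateRep W' 3) (cycSubgroup 3 0 r))
      (κ₀ : galoisCohomology (WeierstrassCurve.torsionGaloisModule W' (((3 : ℕ) : ℤ) ^ j * ((3 : ℕ) : ℤ))) 1)
      (s : ℤ_[3]),
      resSubgroup (WeierstrassCurve.torsionGaloisModule W' (((3 : ℕ) : ℤ) ^ j * ((3 : ℕ) : ℤ))).toTopRep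
          (cycSubgroup 3 0 r) 1 κ₀ = Ψ y →
      galoisCohomology.localization (WeierstrassCurve.torsionGaloisModule W' (((3 : ℕ) : ℤ) ^ j * ((3 : ℕ) : ℤ)))
          (Sum.inr v') 1 κ₀ ∈ propagatedSelmerStructure W' 3 j (Sum.inr v') →
      (∃ l ∈ cycIntLattice 3 (cycLevel 3 0 r),
          ((3 : ℕ) : ℤ_[3]) • Λ' 0 r y -
              (((s * (((3 : ℕ) : ℤ_[3]) - (a' : ℤ_[3]) + 1) : ℤ_[3]) : ℚ_[3]) ⊗ₜ[ℚ]
                (1 : CyclotomicField (cycLevel 3 0 r) ℚ)) =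
            ((3 : ℤ_[3]) ^ (j + 1)) • ∑ g : (ZMod (cycLevel 3 0 r))ˣ,
              ((((((3 : ℕ) : MonoidAlgebra ℤ_[3] (ZMod (cycLevel 3 0 r))ˣ)) -
                  MonoidAlgebra.single w (a' : ℤ_[3]) +
                  MonoidAlgebra.single (w ^ 2) (1 : ℤ_[3])).coeff g : ℤ_[3]) : ℚ_[3]) •
                Algebra.TensorProduct.map (AlgHom.id ℚ ℚ_[3])
                  (sigma (cycLevel 3 0 r) g : CyclotomicField (cycLevel 3 0 r) ℚ →ₐ[ℚ]
                    CyclotomicField (cycLevel 3 0 r) ℚ) l) →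
      Λf (galoisCohomology.localization
          (WeierstrassCurve.torsionGaloisModule W' (((3 : ℕ) : ℤ) ^ j * ((3 : ℕ) : ℤ))) (Sum.inr v') 1 κ₀) =
        PadicInt.toZModPow (j + 1) s

variable (W : WeierstrassCurve ℚ) [W.IsElliptic] [ContinuousSMul ℤ_[3] (W.tateModule 3)]
  (v₃ : HeightOneSpectrum (𝓞 ℚ))
  (Λ : ∀ (k' : ℕ) (r : Finset (HeightOneSpectrum (𝓞 ℚ))),
    H1 (tateRep W 3) (cycSubgroup 3 k' r) →ₗ[ℤ_[3]] ℚ_[3] ⊗[ℚ] CyclotomicField (cycLevel 3 k' r) ℚ)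
  (φ φ' : (tateLocalRep W 3 (Sum.inr v₃)).cohomology 1 →+ ℚ_[3])

/-- ★★★ **The TWISTED rider (ii_τ) DERIVED** (seat w2-c4 gen 9's clause of (C1_τ), VERBATIM, at depth `j`
and EVERY `w` with `w·[3] = 1`) from: the interface of a NORMALISED integral functional `φ′`
(`φ′(y) = s ⇒ Λfin_j(π_{j+1,*} y) = s̄`; seat w2-c3 gen 7's `KimAtThreeDeepUpperLocalLatticeUniform` builds
such `Λfin_j`), the ANOMALOUS normalisation `(3 − a + 1)·φ′ = 3·φ` (`Λfin := exp*_ω/E₃(1)`,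
`E₃(1) = (3 − a + 1)/3`), and ONE TWISTED COMPATIBILITY CLAUSE (X1-int_τ):
`∃ l ∈ L_int, 3•(φ(h) ⊗ 1 − Λ_{0,r}(y)) = 3^{j+1}•P_w·l` for every `T`-lift `h` of `loc_{v₃} κ₀` with
`res κ₀ = Ψ y` (for Kato's witnesses: `exp*` commutes with restriction + the EXACT lattice lemma
`exp*_ω(H¹(L_w,T)) = 3⁻¹P_w·𝒪_w` on the good anomalous rows — DISPLAYED, not proved here).  Proof = w2-c3's
`rider₂_of_compat` with §2's twisted scalar extraction in place of the untwisted one: lift `loc κ₀` to `h`,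
`Λfin(loc κ₀) = φ′(h) mod 3^{j+1}`, and `(φ′(h)(4−a)) ⊗ 1 − 3Λy`, `3Λy − (s(4−a)) ⊗ 1 ∈ 3^{j+1}P_w·L_int`
give `φ′(h) ≡ s`.  Any `W`, `v₃`, `j`; `a ≠ ±4`. [cite: Kim2022StructureSelmer, §3.3–§3.4.1, Lemma 3.4 and the proof of Thm. 3.13 (arXiv v3 pp. 17–18, 26–28)]
[cite: KimNakamura2020, Thm. 2.1 and Cor. 2.4] [cite: BlochKato1990, §3 (Prop. 3.8)] -/
theorem riderτ_of_compatτ {a : ℤ} (ha : a ≠ (3 : ℕ) + 1) (ha' : a ≠ -(((3 : ℕ) : ℤ) + 1))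
    (hφ : ∀ y, ((((3 : ℕ) : ℤ_[3]) - (a : ℤ_[3]) + 1 : ℤ_[3]) : ℚ_[3]) * φ' y = ((3 : ℕ) : ℚ_[3]) * φ y)
    (hint' : ∀ y, ‖φ' y‖ ≤ 1) (j : ℕ)
    (Λfin : galoisCohomology ((W.torsionGaloisModule (((3 : ℕ) : ℤ) ^ j * ((3 : ℕ) : ℤ))).toLocal
      (Sum.inr v₃)) 1 →+ ZMod (3 ^ (j + 1)))
    (hI : ∀ (y : (tateLocalRep W 3 (Sum.inr v₃)).cohomology 1) (s : ℤ_[3]), φ' y = s →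
      Λfin (tateLocalMap W 3 j (Sum.inr v₃) y) = PadicInt.toZModPow (j + 1) s)
    (hcompat : ∀ (r : Finset (HeightOneSpectrum (𝓞 ℚ))) (w : (ZMod (cycLevel 3 0 r))ˣ),
      (w : ZMod (cycLevel 3 0 r)) * ((3 : ℕ) : ZMod (cycLevel 3 0 r)) = 1 →
      ∀ (Ψ : H1 (tateRep W 3) (cycSubgroup 3 0 r) →+
        continuousCohomology 1 (subgroupRep
          (W.torsionGaloisModule (((3 : ℕ) : ℤ) ^ j * ((3 : ℕ) : ℤ))).toTopRep (cycSubgroup 3 0 r))),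
      (∀ (φ₁ : contOneCocycles (subgroupRep (tateRep W 3).toTopRep (cycSubgroup 3 0 r)))
          (ψ : contOneCocycles (subgroupRep
            (W.torsionGaloisModule (((3 : ℕ) : ℤ) ^ j * ((3 : ℕ) : ℤ))).toTopRep (cycSubgroup 3 0 r))),
          (∀ g, ((ψ.1 g : geomTorsion W (((3 : ℕ) : ℤ) ^ j * ((3 : ℕ) : ℤ))) : geomPoints W) =
            TateModule.proj 3 (j + 1) (φ₁.1 g)) →
          Ψ (oneCocycleClass _ φ₁) = oneCocycleClass _ ψ) →
      ∀ (y : H1 (tateRep W 3) (cycSubgroup 3 0 r))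
        (κ₀ : galoisCohomology (W.torsionGaloisModule (((3 : ℕ) : ℤ) ^ j * ((3 : ℕ) : ℤ))) 1)
        (h : (tateLocalRep W 3 (Sum.inr v₃)).cohomology 1),
        resSubgroup (W.torsionGaloisModule (((3 : ℕ) : ℤ) ^ j * ((3 : ℕ) : ℤ))).toTopRep
            (cycSubgroup 3 0 r) 1 κ₀ = Ψ y →
        galoisCohomology.localization (W.torsionGaloisModule (((3 : ℕ) : ℤ) ^ j * ((3 : ℕ) : ℤ)))
            (Sum.inr v₃) 1 κ₀ = tateLocalMap W 3 j (Sum.inr v₃) h →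
        ∃ l ∈ cycIntLattice 3 (cycLevel 3 0 r),
          ((3 : ℕ) : ℤ_[3]) • ((φ h ⊗ₜ[ℚ] (1 : CyclotomicField (cycLevel 3 0 r) ℚ)) - Λ 0 r y) =
            (((3 : ℕ) : ℤ_[3]) ^ (j + 1)) • ∑ g : (ZMod (cycLevel 3 0 r))ˣ,
              ((((((3 : ℕ) : MonoidAlgebra ℤ_[3] (ZMod (cycLevel 3 0 r))ˣ)) -
                  MonoidAlgebra.single w (a : ℤ_[3]) +
                  MonoidAlgebra.single (w ^ 2) (1 : ℤ_[3])).coeff g : ℤ_[3]) : ℚ_[3]) •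
                Algebra.TensorProduct.map (AlgHom.id ℚ ℚ_[3])
                  (sigma (cycLevel 3 0 r) g : CyclotomicField (cycLevel 3 0 r) ℚ →ₐ[ℚ]
                    CyclotomicField (cycLevel 3 0 r) ℚ) l) :
    RIDERτ⟦W, j, v₃, Λ, Λfin, a⟧ := by
  intro r w hw Ψ hΨ y κ₀ s hres hloc hprem
  obtain ⟨h, hh⟩ := (mem_propagatedSelmerStructure_iff W 3 j (Sum.inr v₃) _).mp hloc
  obtain ⟨l₂, hl₂, hc⟩ := hcompat r w hw Ψ hΨ y κ₀ h hres hh.symm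
  obtain ⟨l₁, hl₁, hs⟩ := hprem
  -- the integer `φ′(h)`; the value side `Λfin(loc κ₀) = φ′(h) mod 3^{j+1}`
  set sh : ℤ_[3] := ⟨φ' h, hint' h⟩ with hsh
  have hφ'h : φ' h = (sh : ℚ_[3]) := rfl
  rw [← hh, hI h sh hφ'h]
  -- `(φ′(h)(3 − a + 1)) ⊗ 1 = 3 • (φ(h) ⊗ 1)`
  have hE : ((((sh * (((3 : ℕ) : ℤ_[3]) - (a : ℤ_[3]) + 1)) : ℤ_[3]) : ℚ_[3]) ⊗ₜ[ℚ]
      (1 : CyclotomicField (cycLevel 3 0 r) ℚ)) =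
      ((3 : ℕ) : ℤ_[3]) • (φ h ⊗ₜ[ℚ] (1 : CyclotomicField (cycLevel 3 0 r) ℚ)) := by
    rw [PadicInt.coe_mul, ← hφ'h, mul_comm, hφ h, padicInt_smul_eq_coe_smul, PadicInt.coe_natCast,
      TensorProduct.smul_tmul', smul_eq_mul]
  have h3 : ((3 : ℕ) : ℤ_[3]) = (3 : ℤ_[3]) := by norm_num
  -- §2 with `v := 3 • Λ_{0,r}(y)`
  refine toZModPow_eq_of_sub_eq_smul_eulerTwist (cycLevel 3 0 r) 3 w ha ha'
    (v := ((3 : ℕ) : ℤ_[3]) • Λ 0 r y) ⟨l₂, hl₂, ?_⟩ ⟨l₁, hl₁, ?_⟩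
  · rw [hE, ← smul_sub, hc]
  · rw [hs, h3]

end Rider

end Summit.BirchSwinnertonDyer.BirchSwinnertonDyer.Theorems.KimAtThreeSemiLocalTraceDualTwistScalar

end
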